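import Literature.Barriers.Parity.SiegelZeroDichotomyChowlaTypeI
import Literature.Barriers.Parity.SiegelZeroDichotomyChowlaMajorant
import Literature.Barriers.Parity.SiegelZeroDichotomyChowlaStep3Model
import Literature.Barriers.Parity.SiegelZeroDichotomyProofs
import Literature.NumberTheory.LFunctions.TwistedPolyCharSum
import Literature.NumberTheory.Sieve.CompletionOfSums
import Literature.NumberTheory.Sieve.DivisorBound
import HarnessLib

/-!
# Tao–Teräväinen, Lemma 3.7 at `k = 0` — DISCHARGED

Topic `Literature/Barriers/Parity`, sub-namespace `TaoTeravainen`; the file of the proof DAG of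
`Literature.Barriers.Parity.TaoTeravainen2021_chowla` (T. Tao, J. Teräväinen, *The
Hardy–Littlewood–Chowla conjecture in the presence of a Siegel zero*, J. London Math. Soc. (2) 106
(2022), arXiv:2109.06291) that proves the named fact `TaoTeravainen2021_lemma37_k0`
(`SiegelZeroDichotomyChowlaTypeI.lean`): **Lemma 3.7** at `k = 0`, `J = {1,…,ℓ}`, `d'ⱼ = dⱼ`,
`I = [1, x]`:
`|Σ_{n ≤ x} Π_{h ∈ H} 1_{d_h ∣ n+h} χ((n+h)/d_h)| ≤ C q^{1/2+ε} (Π d_h, q)^{1/2} (x/(q Π d_h) + 1)`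
for the (primitive quadratic) character `χ` of a Siegel zero, following the printed proof:

* Lemma 3.3 (Chinese remainder theorem): the conditions `d_h ∣ n + h` cut out one residue class
  `a (D)`, `D = [d_h]_{h ∈ H}`, or nothing (`system_iff_modEq`), and `Π d_h ≤ h_max^{ℓ²} D` when the
  system is solvable (`SiegelZeroDichotomyChowlaMajorant.lean`);
* on `n = a + Dm` the summand is `Re Π_h χ(A_h m + B_h)` with `A_h = D/d_h`, `B_h = (a+h)/d_h`
  (`prod_realChar_progression`), a `q`-periodic function of `m` on an interval of length
  `≤ x/D + 1` (`filter_mod_eq_image`);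
* its complete sums with additive twists are `≪ 2^{3/2} ℓ^{ω(q)} √q √((q, D·Δ_H))`,
  `Δ_H = Π_{i≠j} |i − j|` (`Literature.NumberTheory.LFunctions.PolyCharSum.norm_polyCharSum_le`:
  the Weil bound (3.13) at the good odd primes — proved in this tree by Stepanov's method,
  `HybridLFunction.norm_hybridSum_add_le` — the trivial bound at the primes dividing `D·Δ_H`
  ("this forces `p = O(1)` … the largest factor `d'` of `q_χ` for which `f` is a constant
  multiple of a square modulo `d'` is `O((d, q_χ))`"), and the Chinese remainder theorem, using that
  `q` is `2^j` times an odd squarefree number);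
* completion of sums (`Literature.NumberTheory.Sieve.LargeSieve.norm_sum_Ioc_le_of_dft_le`) and the
  divisor bound `τ(q) ≪_δ q^δ` (`Literature.NumberTheory.Sieve.exists_card_divisors_le_mul_rpow`) for
  `ℓ^{ω(q)} (1 + log q) ≪_ε q^ε`. [cite: TaoTeravainen2021, Lemma 3.7, Lemma 3.3 and §3.4 (3.13)–(3.16)]
-/

noncomputable section

open Finset
open Literature.NumberTheory.LFunctions.PolyCharSum (polyCharSum polyDisc norm_polyCharSum_le)

namespace Literature.Barriers.Parity

namespace TaoTeravainen

/-! ### Lemma 3.3: the system `d_h ∣ n + h` is one residue class modulo `D = lcm d_h` -/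

/-- **Lemma 3.3 (ii), structural form**: if `n₀` solves `d_h ∣ n₀ + h` for all `h ∈ H`, then
`n` solves the system iff `n ≡ n₀ (mod [d_h]_{h ∈ H})`. [cite: TaoTeravainen2021, Lemma 3.3] -/
theorem system_iff_modEq (H : Finset ℕ) (d : ℕ → ℕ) {n₀ : ℕ} (h₀ : ∀ h ∈ H, d h ∣ n₀ + h)
    (n : ℕ) : (∀ h ∈ H, d h ∣ n + h) ↔ n ≡ n₀ [MOD H.lcm d] := by
  constructor
  · intro hn
    rcases le_total n₀ n with hle | hle
    · refine ((Nat.modEq_iff_dvd' hle).mpr (Finset.lcm_dvd fun h hh => ?_)).symm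
      have := Nat.dvd_sub (hn h hh) (h₀ h hh)
      rwa [Nat.add_sub_add_right] at this
    · refine (Nat.modEq_iff_dvd' hle).mpr (Finset.lcm_dvd fun h hh => ?_)
      have := Nat.dvd_sub (h₀ h hh) (hn h hh)
      rwa [Nat.add_sub_add_right] at this
  · intro hmod h hh
    exact ((hmod.add_right h).dvd_iff (Finset.dvd_lcm hh)).mpr (h₀ h hh)

/-- **The residue class `a (D)` in `[1, x]` as an arithmetic progression**: for `a < D`, `a ≤ x`,
`{n ∈ [1, x] : n % D = a} = {a + Dm : m₀ ≤ m ≤ (x − a)/D}` with `m₀ = 1` if `a = 0` and `m₀ = 0`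
otherwise. [folklore] -/
theorem filter_mod_eq_image {D a x : ℕ} (hD : 0 < D) (haD : a < D) (hax : a ≤ x) :
    (Icc 1 x).filter (fun n => n % D = a) =
      (Icc (if a = 0 then 1 else 0) ((x - a) / D)).image (fun m => a + D * m) := by
  ext n
  simp only [mem_filter, mem_Icc, mem_image]
  constructor
  · rintro ⟨⟨h1, hx⟩, hmod⟩
    have hn : a + D * (n / D) = n := by rw [← hmod]; exact Nat.mod_add_div n D
    refine ⟨n / D, ⟨?_, ?_⟩, hn⟩
    · split_ifs with ha0
      · by_contra hlt
        have h0 : n / D = 0 := Nat.lt_one_iff.mp (not_le.mp hlt)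
        rw [h0, ha0, mul_zero, zero_add] at hn
        omega
      · exact Nat.zero_le _
    · have h2 : n - a = D * (n / D) := by omega
      calc n / D = (n - a) / D := by rw [h2, Nat.mul_div_cancel_left _ hD]
        _ ≤ (x - a) / D := Nat.div_le_div_right (by omega)
  · rintro ⟨m, ⟨hm0, hm1⟩, rfl⟩
    have hDm : D * m ≤ x - a := by
      have := (Nat.le_div_iff_mul_le hD).mp hm1
      rw [mul_comm] at this
      exact this
    refine ⟨⟨?_, by omega⟩, ?_⟩
    · split_ifs at hm0 with ha0
      · have : D * 1 ≤ D * m := Nat.mul_le_mul_left D hm0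
        omega
      · omega
    · rw [Nat.add_mul_mod_self_left, Nat.mod_eq_of_lt haD]

/-! ### Completion of sums on an interval `[m₀, m₁]` -/

/-- Completion of sums for `∑_{m₀ ≤ m ≤ m₁} Φ(m)` (shift the interval by the period `q` to put
it in the form `(A, A+N]`): if all Fourier coefficients of `Φ`, including the zeroth, are `≤ M` in
norm, then `‖∑_{m₀ ≤ m ≤ m₁} Φ(m)‖ ≤ M (m₁+1)/q + M (1 + log q)`. [cite: TaoTeravainen2021, §3.4 ("completion of sums (see [ik])")] -/
theorem norm_sum_Icc_le_of_dft_le {q : ℕ} [NeZero q] (hq : 2 ≤ q) (Φ : ZMod q → ℂ) {M : ℝ}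
    (hM0 : ‖∑ j : ZMod q, Φ j‖ ≤ M) (hM : ∀ k : ZMod q, k ≠ 0 → ‖ZMod.dft Φ k‖ ≤ M)
    (m₀ m₁ : ℕ) :
    ‖∑ m ∈ Icc m₀ m₁, Φ (m : ZMod q)‖ ≤ M * ((m₁ + 1 : ℝ) / q) + M * (1 + Real.log q) := by
  have hMnn : 0 ≤ M := (norm_nonneg _).trans hM0
  have hq1 : (1 : ℝ) ≤ q := by exact_mod_cast (by omega : 1 ≤ q)
  have hlog : 0 ≤ Real.log q := Real.log_nonneg hq1
  rcases lt_or_ge m₁ m₀ with hlt | hle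
  · rw [Finset.Icc_eq_empty (by omega), Finset.sum_empty, norm_zero]
    positivity
  -- shift by `q`
  have hshift : ∑ m ∈ Icc m₀ m₁, Φ (m : ZMod q) = ∑ n ∈ Icc (m₀ + q) (m₁ + q), Φ (n : ZMod q) := by
    rw [← Finset.image_add_right_Icc, Finset.sum_image fun a _ b _ h => by omega]
    refine Finset.sum_congr rfl fun m _ => ?_
    congr 1
    push_cast
    rw [ZMod.natCast_self, add_zero]
  have hIoc : Icc (m₀ + q) (m₁ + q) = Ioc (m₀ + q - 1) ((m₀ + q - 1) + (m₁ + 1 - m₀)) := by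
    ext n; simp only [mem_Icc, mem_Ioc]; omega
  rw [hshift, hIoc]
  have h := Literature.NumberTheory.Sieve.LargeSieve.norm_sum_Ioc_le_of_dft_le hq Φ hM0 hM
    (m₀ + q - 1) (m₁ + 1 - m₀)
  refine h.trans (add_le_add (mul_le_mul_of_nonneg_left ?_ hMnn) le_rfl)
  gcongr
  push_cast [Nat.cast_sub (by omega : m₀ ≤ m₁ + 1)]
  linarith [(Nat.cast_nonneg m₀ : (0 : ℝ) ≤ m₀)]

/-! ### The complete sums of the progression values are `polyCharSum`s -/

/-- `𝓕Φ(k) = Σ_z Φ(z) e(−zk/q)` is the `polyCharSum` with the additive character `e(−k ·)`.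
[folklore] -/
theorem dft_eq_polyCharSum (q : ℕ) [NeZero q] (χ : DirichletCharacter ℂ q) (H : Finset ℕ)
    (A B : ℕ → ℤ) (k : ZMod q) :
    ZMod.dft (fun z : ZMod q => ∏ h ∈ H, χ ((A h : ZMod q) * z + (B h : ZMod q))) k =
      polyCharSum q χ H A B ((ZMod.stdAddChar (N := q)).mulShift (-k)) := by
  rw [ZMod.dft_apply]
  unfold polyCharSum
  refine Finset.sum_congr rfl fun j _ => ?_
  rw [smul_eq_mul, mul_comm, AddChar.mulShift_apply]
  congr 2
  ring

/-- `Σ_z Φ(z)` is the `polyCharSum` with the trivial additive character. [folklore] -/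
theorem sum_eq_polyCharSum (q : ℕ) [NeZero q] (χ : DirichletCharacter ℂ q) (H : Finset ℕ)
    (A B : ℕ → ℤ) :
    ∑ z : ZMod q, ∏ h ∈ H, χ ((A h : ZMod q) * z + (B h : ZMod q)) =
      polyCharSum q χ H A B 1 := by
  unfold polyCharSum
  simp only [AddChar.one_apply, mul_one]

/-! ### Numerical inputs: `ℓ^{ω(q)} ≤ τ(q)^ℓ`, `1 + log q ≪_ε q^{ε/4}` -/

/-- `ℓ^{ω(q)} ≤ τ(q)^ℓ` (from `ℓ ≤ 2^ℓ` and `2^{ω(q)} ≤ τ(q)`). [folklore] -/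
theorem pow_card_primeFactors_le (ℓ : ℕ) {q : ℕ} (hq : q ≠ 0) :
    (ℓ : ℝ) ^ q.primeFactors.card ≤ ((#q.divisors : ℕ) : ℝ) ^ ℓ := by
  have h1 : ℓ ≤ 2 ^ ℓ := Nat.lt_two_pow_self.le
  have h2 : 2 ^ q.primeFactors.card ≤ #q.divisors := by
    rw [Nat.card_divisors hq, ← Finset.prod_const]
    refine Finset.prod_le_prod' fun p hp => ?_
    have := (Nat.prime_of_mem_primeFactors hp).factorization_pos_of_dvd hq
      (Nat.dvd_of_mem_primeFactors hp)
    omega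
  calc (ℓ : ℝ) ^ q.primeFactors.card ≤ ((2 ^ ℓ : ℕ) : ℝ) ^ q.primeFactors.card :=
        pow_le_pow_left₀ (Nat.cast_nonneg _) (by exact_mod_cast h1) _
    _ = ((2 ^ q.primeFactors.card : ℕ) : ℝ) ^ ℓ := by push_cast; rw [← pow_mul, mul_comm, pow_mul]
    _ ≤ ((#q.divisors : ℕ) : ℝ) ^ ℓ := pow_le_pow_left₀ (Nat.cast_nonneg _) (by exact_mod_cast h2) _

/-- `1 + log q ≤ (1 + 4/ε) q^{ε/4}` for `q ≥ 1`, `ε > 0`. [folklore] -/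
theorem one_add_log_le {q : ℝ} (hq : 1 ≤ q) {ε : ℝ} (hε : 0 < ε) :
    1 + Real.log q ≤ (1 + 4 / ε) * q ^ (ε / 4) := by
  have h1 : 1 ≤ q ^ (ε / 4) := Real.one_le_rpow hq (by positivity)
  have h2 : Real.log q ≤ q ^ (ε / 4) / (ε / 4) := Real.log_le_rpow_div (by linarith) (by positivity)
  calc 1 + Real.log q ≤ q ^ (ε / 4) + q ^ (ε / 4) / (ε / 4) := add_le_add h1 h2
    _ = (1 + 4 / ε) * q ^ (ε / 4) := by rw [div_div_eq_mul_div]; ring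

/-! ### The divisibility `p ∣ Δ ⇒ p ∣ D·Δ_H` for the progression data -/

/-- For `A_h = D/d_h`, `B_h = (a+h)/d_h` (exact divisions, `d_h ∣ D`, `d_h ∣ a + h`):
`d_i d_j (A_i B_j − A_j B_i) = D (j − i)`. [cite: TaoTeravainen2021, proof of Lemma 3.7] -/
theorem cross_mul_eq {D a i j di dj : ℕ} (hiD : di ∣ D) (hjD : dj ∣ D) (hia : di ∣ a + i)
    (hja : dj ∣ a + j) :
    ((di : ℤ) * dj) * (((D / di : ℕ) : ℤ) * (((a + j) / dj : ℕ) : ℤ) -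
      ((D / dj : ℕ) : ℤ) * (((a + i) / di : ℕ) : ℤ)) = (D : ℤ) * ((j : ℤ) - i) := by
  have e1 : ((di : ℤ)) * ((D / di : ℕ) : ℤ) = D := by exact_mod_cast Nat.mul_div_cancel' hiD
  have e2 : ((dj : ℤ)) * (((a + j) / dj : ℕ) : ℤ) = (a : ℤ) + j := by
    exact_mod_cast Nat.mul_div_cancel' hja
  have e3 : ((dj : ℤ)) * ((D / dj : ℕ) : ℤ) = D := by exact_mod_cast Nat.mul_div_cancel' hjD
  have e4 : ((di : ℤ)) * (((a + i) / di : ℕ) : ℤ) = (a : ℤ) + i := by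
    exact_mod_cast Nat.mul_div_cancel' hia
  linear_combination ((dj : ℤ) * (((a + j) / dj : ℕ) : ℤ)) * e1 + (D : ℤ) * e2 -
    ((di : ℤ) * (((a + i) / di : ℕ) : ℤ)) * e3 - (D : ℤ) * e4

end TaoTeravainen

open TaoTeravainen

set_option maxHeartbeats 1600000 in
/-- **Tao–Teräväinen 2022, Lemma 3.7 at `k = 0` — PROVED.** For fixed distinct shifts `H`
(`h ≥ 1`, `H ≠ ∅`) and `ε > 0` there is `C` such that for every Siegel zero (`IsSiegelZero χ η`,
conductor `q`), every `x ∈ ℕ` and all moduli `d_h ≥ 1`,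
`|Σ_{n=1}^{x} Π_{h ∈ H} 1_{d_h ∣ n+h} χ((n+h)/d_h)| ≤ C q^{1/2+ε} √((Π d_h, q)) (x/(q Π d_h) + 1)`.
[cite: TaoTeravainen2021, Lemma 3.7 (with Lemma 3.3 and §3.4 (3.13)–(3.16))] -/
theorem TaoTeravainen2021_lemma37_k0_holds : TaoTeravainen2021_lemma37_k0 := by
  intro H hH hH1 ε hε
  classical
  -- constants depending on `H` and `ε` only
  set ℓ : ℕ := #H with hℓ
  have hℓ1 : 1 ≤ ℓ := Finset.card_pos.mpr hH
  set hmax : ℕ := H.max' hH with hhmax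
  have hhmax1 : 1 ≤ hmax := (hH1 _ (H.max'_mem hH))
  have hHle : ∀ h ∈ H, h ≤ hmax := fun h hh => H.le_max' h hh
  set K : ℝ := (hmax : ℝ) ^ (ℓ * ℓ) with hK
  have hK1 : 1 ≤ K := one_le_pow₀ (by exact_mod_cast hhmax1)
  set ΔH : ℕ := ∏ i ∈ H, ∏ j ∈ H.erase i, Int.natAbs ((j : ℤ) - i) with hΔH
  have hΔH0 : 0 < ΔH := by
    refine Finset.prod_pos fun i _ => Finset.prod_pos fun j hj => ?_
    refine Int.natAbs_pos.mpr (sub_ne_zero.mpr ?_)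
    exact_mod_cast Finset.ne_of_mem_erase hj
  set δ : ℝ := ε / (4 * ℓ) with hδ
  have hδ0 : 0 < δ := by positivity
  obtain ⟨Cδ, hCδ1, hCδ⟩ := Literature.NumberTheory.Sieve.exists_card_divisors_le_mul_rpow hδ0
  set C : ℝ := 2 * (2 : ℝ) ^ ((3 : ℝ) / 2) * Cδ ^ ℓ * (1 + 4 / ε) * Real.sqrt ΔH * K with hC
  have hC0 : 0 ≤ C := by positivity
  refine ⟨C, ?_⟩
  intro q _ χ η hSZ x d hd
  have hq3 : 3 ≤ q := hSZ.three_le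
  have hq2 : 2 ≤ q := by omega
  obtain ⟨hprim, hquad, -, -⟩ := hSZ
  have hq0 : q ≠ 0 := by omega
  have hq1 : (1 : ℝ) ≤ q := by exact_mod_cast (by omega : 1 ≤ q)
  have hqpos : (0 : ℝ) < q := by positivity
  have hP0 : 0 < ∏ h ∈ H, d h := Finset.prod_pos fun h hh => hd h hh
  have hPR : (0 : ℝ) < ∏ h ∈ H, (d h : ℝ) := Finset.prod_pos fun h hh => by exact_mod_cast hd h hh
  -- the target quantities
  set G : ℝ := Real.sqrt (Nat.gcd (∏ h ∈ H, d h) q) with hG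
  set X : ℝ := (x : ℝ) / ((q : ℝ) * ∏ h ∈ H, (d h : ℝ)) + 1 with hX
  have hG1 : 1 ≤ G := by
    rw [hG, ← Real.sqrt_one]
    exact Real.sqrt_le_sqrt (by exact_mod_cast Nat.gcd_pos_of_pos_right _ (by omega))
  have hG0 : 0 < G := zero_lt_one.trans_le hG1
  have hX1 : 1 ≤ X := le_add_of_nonneg_left (by positivity)
  have hX0 : 0 < X := zero_lt_one.trans_le hX1
  have hK0 : 0 < K := zero_lt_one.trans_le hK1
  have hRHS : 0 ≤ C * (q : ℝ) ^ ((1 : ℝ) / 2 + ε) * G * X := by positivity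
  -- the summand as an `ite` over the whole system
  set F : ℕ → ℝ := fun n => ∏ h ∈ H, (if d h ∣ n + h then realChar χ ((n + h) / d h) else 0)
    with hF
  set g : ℕ → ℝ := fun n => ∏ h ∈ H, realChar χ ((n + h) / d h) with hg
  have hFg : ∀ n, F n = if (∀ h ∈ H, d h ∣ n + h) then g n else 0 := fun n =>
    Finset.prod_ite_zero
  show |∑ n ∈ Icc 1 x, F n| ≤ C * (q : ℝ) ^ ((1 : ℝ) / 2 + ε) * G * X
  -- Case 1: the system has no solution in `[1, x]`
  by_cases hsol : ∃ n₀ ∈ Icc 1 x, ∀ h ∈ H, d h ∣ n₀ + h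
  swap
  · have h0 : ∑ n ∈ Icc 1 x, F n = 0 := Finset.sum_eq_zero fun n hn => by
      rw [hFg, if_neg (fun h => hsol ⟨n, hn, h⟩)]
    rw [h0, abs_zero]
    exact hRHS
  -- Case 2: a solution `n₀` exists; the modulus `D` and the residue `a`
  obtain ⟨n₀, hn₀, hsol₀⟩ := hsol
  rw [mem_Icc] at hn₀
  set D : ℕ := H.lcm d with hDdef
  have hdD : ∀ h ∈ H, d h ∣ D := fun h hh => Finset.dvd_lcm hh
  have hDP : D ∣ ∏ h ∈ H, d h := Finset.lcm_dvd fun h hh => Finset.dvd_prod_of_mem d hh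
  have hD0 : 0 < D := Nat.pos_of_dvd_of_pos hDP hP0
  set a : ℕ := n₀ % D with hadef
  have haD : a < D := Nat.mod_lt _ hD0
  have hax : a ≤ x := (Nat.mod_le _ _).trans hn₀.2
  have hmod₀ : a ≡ n₀ [MOD D] := Nat.mod_modEq n₀ D
  have hsola : ∀ h ∈ H, d h ∣ a + h := fun h hh =>
    ((hmod₀.add_right h).dvd_iff (hdD h hh)).mpr (hsol₀ h hh)
  -- Step 1: restrict to the progression `n ≡ a (D)`
  have hS1 : ∑ n ∈ Icc 1 x, F n = ∑ n ∈ (Icc 1 x).filter (fun n => n % D = a), g n := by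
    rw [Finset.sum_filter]
    refine Finset.sum_congr rfl fun n _ => ?_
    rw [hFg]
    by_cases hP : ∀ h ∈ H, d h ∣ n + h
    · have hc : n % D = a := (system_iff_modEq H d hsol₀ n).mp hP
      rw [if_pos hP, if_pos hc]
    · have hc : ¬ n % D = a := fun h => hP ((system_iff_modEq H d hsol₀ n).mpr h)
      rw [if_neg hP, if_neg hc]
  -- Step 2: parametrise the progression by `m`, `n = a + D m`
  set m₀ : ℕ := if a = 0 then 1 else 0 with hm₀
  set m₁ : ℕ := (x - a) / D with hm₁
  have hS2 : ∑ n ∈ (Icc 1 x).filter (fun n => n % D = a), g n =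
      ∑ m ∈ Icc m₀ m₁, g (a + D * m) := by
    rw [filter_mod_eq_image hD0 haD hax, Finset.sum_image]
    intro m _ m' _ hmm
    have hmm' : a + D * m = a + D * m' := hmm
    exact Nat.eq_of_mul_eq_mul_left hD0 (by omega)
  -- Step 3: the values on the progression are `Re Π_h χ(A_h m + B_h)`
  set A : ℕ → ℤ := fun h => ((D / d h : ℕ) : ℤ) with hA
  set B : ℕ → ℤ := fun h => (((a + h) / d h : ℕ) : ℤ) with hB
  set Φ : ZMod q → ℂ := fun z => ∏ h ∈ H, χ ((A h : ZMod q) * z + (B h : ZMod q)) with hΦ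
  have hval : ∀ m : ℕ, g (a + D * m) = (Φ (m : ZMod q)).re := by
    intro m
    have hc : Φ (m : ZMod q) = ((g (a + D * m) : ℝ) : ℂ) := by
      simp only [hΦ, hg]
      rw [Complex.ofReal_prod]
      refine Finset.prod_congr rfl fun h hh => ?_
      rw [realChar_coe χ hquad]
      congr 1
      have hdiv : (a + D * m + h) / d h = (a + h) / d h + D / d h * m := by
        rw [show a + D * m + h = (a + h) + D * m by ring, Nat.add_div_of_dvd_right (hsola h hh),
          mul_comm D m, Nat.mul_div_assoc _ (hdD h hh), mul_comm]
      rw [hdiv]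
      simp only [hA, hB, Int.cast_natCast, Nat.cast_add, Nat.cast_mul]
      ring
    rw [hc, Complex.ofReal_re]
  have hS3 : ∑ m ∈ Icc m₀ m₁, g (a + D * m) = (∑ m ∈ Icc m₀ m₁, Φ (m : ZMod q)).re := by
    rw [Complex.re_sum]
    exact Finset.sum_congr rfl fun m _ => hval m
  -- Step 4: the Fourier bounds of `Φ` from `norm_polyCharSum_le` with `R = D · Δ_H`
  set R : ℕ := D * ΔH with hRdef
  have hR : ∀ p ∈ q.primeFactors, p ≠ 2 → (p : ℤ) ∣ polyDisc H A B → p ∣ R := by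
    intro p hp _ hdvd
    have hpP : p.Prime := Nat.prime_of_mem_primeFactors hp
    have hpZ : Prime (p : ℤ) := Nat.prime_iff_prime_int.mp hpP
    unfold polyDisc at hdvd
    rcases hpZ.dvd_or_dvd hdvd with h1 | h2
    · obtain ⟨h, hh, hph⟩ := hpZ.exists_mem_finset_dvd h1
      have hpD : p ∣ D := (Int.natCast_dvd_natCast.mp hph).trans (Nat.div_dvd_of_dvd (hdD h hh))
      exact hpD.mul_right _
    · obtain ⟨i, hi, h2'⟩ := hpZ.exists_mem_finset_dvd h2
      obtain ⟨j, hj, hpij⟩ := hpZ.exists_mem_finset_dvd h2'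
      have hj' : j ∈ H := Finset.mem_of_mem_erase hj
      have hkey := cross_mul_eq (hdD i hi) (hdD j hj') (hsola i hi) (hsola j hj')
      have hpD : (p : ℤ) ∣ (D : ℤ) * ((j : ℤ) - i) := by
        rw [← hkey]; exact dvd_mul_of_dvd_right hpij _
      rcases hpZ.dvd_or_dvd hpD with h3 | h4
      · exact (Int.natCast_dvd_natCast.mp h3).mul_right _
      · refine Dvd.dvd.mul_left ?_ _
        have h5 : p ∣ Int.natAbs ((j : ℤ) - i) := Int.natCast_dvd.mp h4
        exact h5.trans ((Finset.dvd_prod_of_mem (fun j : ℕ => Int.natAbs ((j : ℤ) - i)) hj).trans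
          (Finset.dvd_prod_of_mem (fun i : ℕ => ∏ j ∈ H.erase i, Int.natAbs ((j : ℤ) - i)) hi))
  set Mq : ℝ := (2 : ℝ) ^ ((3 : ℝ) / 2) * (ℓ : ℝ) ^ q.primeFactors.card * Real.sqrt q *
    Real.sqrt (Nat.gcd q R) with hMq
  have hM0 : ‖∑ j : ZMod q, Φ j‖ ≤ Mq := by
    rw [hΦ, sum_eq_polyCharSum]
    exact norm_polyCharSum_le hprim hquad hH A B _ hR
  have hMk : ∀ k : ZMod q, k ≠ 0 → ‖ZMod.dft Φ k‖ ≤ Mq := fun k _ => by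
    rw [hΦ, dft_eq_polyCharSum]
    exact norm_polyCharSum_le hprim hquad hH A B _ hR
  have hS4 := norm_sum_Icc_le_of_dft_le hq2 Φ hM0 hMk m₀ m₁
  -- Step 5: numerics
  have hMqnn : 0 ≤ Mq := by positivity
  -- (a) `Mq ≤ c₁ q^{ε/4} √q G √ΔH`
  have hℓω : (ℓ : ℝ) ^ q.primeFactors.card ≤ Cδ ^ ℓ * (q : ℝ) ^ (ε / 4) := by
    refine (pow_card_primeFactors_le ℓ hq0).trans ?_
    have hτ := hCδ q hq0
    calc ((#q.divisors : ℕ) : ℝ) ^ ℓ ≤ (Cδ * (q : ℝ) ^ δ) ^ ℓ :=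
          pow_le_pow_left₀ (Nat.cast_nonneg _) hτ ℓ
      _ = Cδ ^ ℓ * (q : ℝ) ^ (ε / 4) := by
          rw [mul_pow, ← Real.rpow_natCast ((q : ℝ) ^ δ) ℓ, ← Real.rpow_mul hqpos.le]
          congr 2
          rw [hδ]; field_simp
  have hgcd : Real.sqrt (Nat.gcd q R) ≤ G * Real.sqrt ΔH := by
    rw [hG, ← Real.sqrt_mul (Nat.cast_nonneg _)]
    refine Real.sqrt_le_sqrt ?_
    have h1 : Nat.gcd q R ≤ Nat.gcd q D * Nat.gcd q ΔH :=
      Nat.le_of_dvd (Nat.mul_pos (Nat.gcd_pos_of_pos_left _ (by omega))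
        (Nat.gcd_pos_of_pos_left _ (by omega))) (Nat.gcd_mul_right_dvd_mul_gcd q D ΔH)
    have h2 : Nat.gcd q D ≤ Nat.gcd (∏ h ∈ H, d h) q := by
      rw [Nat.gcd_comm (∏ h ∈ H, d h)]
      exact Nat.le_of_dvd (Nat.gcd_pos_of_pos_left _ (by omega)) (Nat.gcd_dvd_gcd_of_dvd_right _ hDP)
    have h3 : Nat.gcd q ΔH ≤ ΔH := Nat.gcd_le_right _ hΔH0
    calc ((Nat.gcd q R : ℕ) : ℝ) ≤ ((Nat.gcd q D * Nat.gcd q ΔH : ℕ) : ℝ) := by exact_mod_cast h1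
      _ ≤ ((Nat.gcd (∏ h ∈ H, d h) q * ΔH : ℕ) : ℝ) := by exact_mod_cast Nat.mul_le_mul h2 h3
      _ = _ := by push_cast; ring
  have hE1 : Mq ≤ ((2 : ℝ) ^ ((3 : ℝ) / 2) * Cδ ^ ℓ) * ((q : ℝ) ^ (ε / 4) * Real.sqrt q) * G *
      Real.sqrt ΔH := by
    calc Mq = (2 : ℝ) ^ ((3 : ℝ) / 2) * (ℓ : ℝ) ^ q.primeFactors.card * Real.sqrt q *
          Real.sqrt (Nat.gcd q R) := rfl
      _ ≤ (2 : ℝ) ^ ((3 : ℝ) / 2) * (Cδ ^ ℓ * (q : ℝ) ^ (ε / 4)) * Real.sqrt q *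
          (G * Real.sqrt ΔH) := by gcongr
      _ = _ := by ring
  -- (b) `1 + log q ≤ (1 + 4/ε) q^{ε/4}`
  have hE2 : 1 + Real.log q ≤ (1 + 4 / ε) * (q : ℝ) ^ (ε / 4) := one_add_log_le hq1 hε
  have hlog1 : 1 ≤ 1 + Real.log q := le_add_of_nonneg_right (Real.log_nonneg hq1)
  -- (c) `(m₁ + 1)/q + 1 ≤ 2 K X`
  have hpair : (∏ h ∈ H, (d h : ℝ)) ≤ (D : ℝ) * K := by
    have hgcdh : ∀ i ∈ H, ∀ j ∈ H.erase i, Nat.gcd (d i) (d j) ≤ hmax := by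
      intro i hi j hj
      have hji : j ≠ i := Finset.ne_of_mem_erase hj
      have hj' : j ∈ H := Finset.mem_of_mem_erase hj
      have h1 : Nat.gcd (d i) (d j) ∣ n₀ + i := (Nat.gcd_dvd_left _ _).trans (hsol₀ i hi)
      have h2 : Nat.gcd (d i) (d j) ∣ n₀ + j := (Nat.gcd_dvd_right _ _).trans (hsol₀ j hj')
      rcases lt_or_gt_of_ne hji with hlt | hlt
      · have h3 : Nat.gcd (d i) (d j) ∣ i - j := by
          have := Nat.dvd_sub h1 h2
          rwa [Nat.add_sub_add_left] at this
        exact (Nat.le_of_dvd (by omega) h3).trans (by have := hHle i hi; omega)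
      · have h3 : Nat.gcd (d i) (d j) ∣ j - i := by
          have := Nat.dvd_sub h2 h1
          rwa [Nat.add_sub_add_left] at this
        exact (Nat.le_of_dvd (by omega) h3).trans (by have := hHle j hj'; omega)
    have hpg : pairGcdProd H d ≤ hmax ^ (ℓ * ℓ) := by
      unfold pairGcdProd
      calc ∏ i ∈ H, ∏ j ∈ H.erase i, Nat.gcd (d i) (d j) ≤ ∏ i ∈ H, ∏ _j ∈ H.erase i, hmax :=
            Finset.prod_le_prod' fun i hi => Finset.prod_le_prod' fun j hj => hgcdh i hi j hj
        _ = hmax ^ (∑ i ∈ H, #(H.erase i)) := by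
            rw [Finset.prod_congr rfl fun i _ => Finset.prod_const hmax, Finset.prod_pow_eq_pow_sum]
        _ ≤ hmax ^ (ℓ * ℓ) := by
            refine Nat.pow_le_pow_right hhmax1 ?_
            calc ∑ i ∈ H, #(H.erase i) ≤ ∑ _i ∈ H, #H := Finset.sum_le_sum fun i _ => Finset.card_erase_le
              _ = ℓ * ℓ := by rw [Finset.sum_const, smul_eq_mul]
    have h1 := prod_le_lcm_mul_pairGcdProd H d hd
    have h2 : ((∏ h ∈ H, d h : ℕ) : ℝ) ≤ ((D * pairGcdProd H d : ℕ) : ℝ) := by exact_mod_cast h1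
    push_cast at h2
    refine h2.trans (mul_le_mul_of_nonneg_left ?_ (Nat.cast_nonneg _))
    rw [hK]; exact_mod_cast hpg
  have hD0R : (0 : ℝ) < D := by exact_mod_cast hD0
  have hE3 : ((m₁ : ℝ) + 1) / q + 1 ≤ 2 * K * X := by
    have hm1x : (m₁ : ℝ) ≤ x / D := by
      rw [hm₁]
      calc (((x - a) / D : ℕ) : ℝ) ≤ ((x - a : ℕ) : ℝ) / D := Nat.cast_div_le
        _ ≤ (x : ℝ) / D := by
            gcongr
            exact_mod_cast Nat.sub_le x a
    have hxD : (x : ℝ) / D ≤ K * ((x : ℝ) / ∏ h ∈ H, (d h : ℝ)) := by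
      rw [div_le_iff₀ hD0R]
      have h1 : 1 ≤ (D : ℝ) * K / ∏ h ∈ H, (d h : ℝ) := (one_le_div hPR).mpr hpair
      calc (x : ℝ) ≤ (x : ℝ) * ((D : ℝ) * K / ∏ h ∈ H, (d h : ℝ)) :=
            le_mul_of_one_le_right (Nat.cast_nonneg x) h1
        _ = K * ((x : ℝ) / ∏ h ∈ H, (d h : ℝ)) * D := by ring
    have hq1' : (1 : ℝ) / q ≤ 1 := by rw [div_le_one hqpos]; exact hq1
    calc ((m₁ : ℝ) + 1) / q + 1 ≤ ((x : ℝ) / D + 1) / q + 1 := by gcongr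
      _ = (x : ℝ) / D / q + 1 / q + 1 := by ring
      _ ≤ K * ((x : ℝ) / ∏ h ∈ H, (d h : ℝ)) / q + 1 + 1 := by gcongr
      _ = K * ((x : ℝ) / ((q : ℝ) * ∏ h ∈ H, (d h : ℝ))) + 2 := by
          rw [mul_div_assoc, div_div, mul_comm (∏ h ∈ H, (d h : ℝ)) (q : ℝ)]; ring
      _ ≤ 2 * K * X := by
          rw [hX]
          nlinarith [hK1, (by positivity : (0 : ℝ) ≤ (x : ℝ) / ((q : ℝ) * ∏ h ∈ H, (d h : ℝ)))]
  -- (d) `q^{ε/4} √q · q^{ε/4} ≤ q^{1/2+ε}`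
  have hE4 : ((q : ℝ) ^ (ε / 4) * Real.sqrt q) * (q : ℝ) ^ (ε / 4) ≤ (q : ℝ) ^ ((1 : ℝ) / 2 + ε) := by
    rw [Real.sqrt_eq_rpow, ← Real.rpow_add hqpos, ← Real.rpow_add hqpos]
    refine Real.rpow_le_rpow_of_exponent_le hq1 ?_
    linarith
  -- assemble
  rw [hS1, hS2, hS3]
  refine (Complex.abs_re_le_norm _).trans (hS4.trans ?_)
  have hm1nn : (0 : ℝ) ≤ ((m₁ : ℝ) + 1) / q := by positivity
  calc Mq * (((m₁ : ℝ) + 1) / q) + Mq * (1 + Real.log q)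
      ≤ Mq * (1 + Real.log q) * (((m₁ : ℝ) + 1) / q + 1) := by
        nlinarith [mul_nonneg (sub_nonneg.mpr hlog1) (mul_nonneg hMqnn hm1nn)]
    _ ≤ (((2 : ℝ) ^ ((3 : ℝ) / 2) * Cδ ^ ℓ) * ((q : ℝ) ^ (ε / 4) * Real.sqrt q) * G *
          Real.sqrt ΔH) * ((1 + 4 / ε) * (q : ℝ) ^ (ε / 4)) * (2 * K * X) := by
        refine mul_le_mul (mul_le_mul hE1 hE2 (by positivity) (by positivity)) hE3 (by positivity)
          (by positivity)
    _ = C * (((q : ℝ) ^ (ε / 4) * Real.sqrt q) * (q : ℝ) ^ (ε / 4)) * G * X := by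
        rw [hC]; ring
    _ ≤ C * (q : ℝ) ^ ((1 : ℝ) / 2 + ε) * G * X :=
        mul_le_mul_of_nonneg_right (mul_le_mul_of_nonneg_right
          (mul_le_mul_of_nonneg_left hE4 hC0) hG0.le) hX0.le

end Literature.Barriers.Parity
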